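import Mathlib
import Summits.Ventures.PercRepro.TriangleCapFourRowFourT

/-!
# PercRepro — THE ROW `a = 4` AT `r = 4` AT THE SHARP GAP `T = 2k − 14`, ASSEMBLED, AND THE NON-BIPARTITE
SECOND-BEST VALUE ON `(k, 4, 4)` (p3, gen 46; part 199z, second half)

`four_four_second_order_T (12 ≤ k)`: `4`-bipartite or `Σ_v d(v)² + 4 (k − 5) + (2k − 14) ≤ m k` — the cap (part
199t), the convexity of `[4, k − 5]`, the deletions `d ≤ 3` onto the landed cells; `four_four_nonbip_second_best`:
the non-`4`-bipartite second-best value is EXACTLY `m k − 4 (k − 5) − (2k − 14)`, attained by `tFamilyGen (k − 1) 4 2`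
(bipartite for no `A`). With part 199e the non-bipartite stability table reads `nonbipGap = 2k − 18` on `(k, 4, 3)`
and `2k − 14` on `(k, 4, 4)`: the family `T` on the row `a = 4` from `r = 2` on. Axioms: standard.
-/

namespace PercRepro

namespace TriangleCap

namespace C047

open Finset

variable {V : Type*} [Fintype V] [DecidableEq V]

/-- **THE ROW `a = 4` AT `r = 4` AT THE SHARP GAP:** `K₄⁻`-free, `m + 4 = 4 (k − 4)`, `12 ≤ k` ⇒ `D` is a spanning
subgraph of some `K(A, Aᶜ)` with `|A| = 4`, or `Σ_v d(v)² + 4 (k − 5) + (2k − 14) ≤ m k`. -/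
theorem four_four_second_order_T (D : SimpleGraph V) [DecidableRel D.Adj] (hK : K4mFree D)
    (hk : 12 ≤ Fintype.card V) (hm : D.edgeFinset.card + 4 = 4 * (Fintype.card V - 4)) :
    (∃ A : Finset V, A.card = 4 ∧ BipSub D A) ∨
      ∑ v, deg D v * deg D v + 4 * (Fintype.card V - 5) + (2 * Fintype.card V - 14) ≤
        D.edgeFinset.card * Fintype.card V := by
  -- (A) a vertex at the cap `k − 4`
  by_cases hx : ∃ x, deg D x + 4 = Fintype.card V
  · obtain ⟨x, hx⟩ := hx
    exact four_four_cap_T D hK hk hm x hx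
  push Not at hx
  have hcap : ∀ v, deg D v + 4 ≤ Fintype.card V := fun v =>
    deg_add_le_card_of_dense D hK 4 (by norm_num) (by omega)
      (cap_arith 4 (Fintype.card V) D.edgeFinset.card 4 (by norm_num) (by omega) (by omega)) v
  have hcap' : ∀ v, deg D v + 5 ≤ Fintype.card V := fun v => by
    have h1 := hcap v
    have h2 := hx v
    omega
  have hcap6 : ∀ v, deg D v ≤ (Fintype.card V - 6) + 1 := fun v => by have := hcap' v; omega
  -- (B) every degree `≥ 4`: the convexity of the window `[4, k − 5]`
  by_cases hdeg : ∀ v, 4 ≤ deg D v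
  · exact Or.inr (four_four_convex_T D hk hm hcap' hdeg)
  push Not at hdeg
  obtain ⟨z, hz⟩ := hdeg
  -- the deletion bookkeeping
  have hK' := k4mFree_del D hK z
  have hcard' := card_del z
  have hedges' := card_edges_del D z
  have hsq := sum_deg_sq_del D z
  have hT := sum_del_nbhd_le D z (Fintype.card V - 6) hcap6
  have hNz := card_nbhd_del D z
  obtain ⟨T, hTdef⟩ : ∃ T, ∑ a : {v : V // v ≠ z}, (if D.Adj a.1 z then deg (del D z) a else 0) = T := ⟨_, rfl⟩
  obtain ⟨S', hS'def⟩ : ∃ S', ∑ a : {v : V // v ≠ z}, deg (del D z) a * deg (del D z) a = S' := ⟨_, rfl⟩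
  obtain ⟨m', hm'def⟩ : ∃ m', (del D z).edgeFinset.card = m' := ⟨_, rfl⟩
  obtain ⟨Nz, hNzdef⟩ : ∃ Nz : Finset {v : V // v ≠ z},
      Nz = univ.filter (fun a : {v : V // v ≠ z} => D.Adj a.1 z) := ⟨_, rfl⟩
  have hmemNz : ∀ a : {v : V // v ≠ z}, a ∈ Nz ↔ D.Adj a.1 z := fun a => by
    rw [hNzdef, mem_filter]
    simp only [mem_univ, true_and]
  rw [← hNzdef] at hNz
  rw [hTdef, hS'def] at hsq
  rw [hTdef] at hT
  rw [hm'def] at hedges'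
  obtain ⟨s, hs⟩ : ∃ s, Fintype.card V = s + 12 := ⟨Fintype.card V - 12, by omega⟩
  have hcardW' : Fintype.card {v : V // v ≠ z} = s + 11 := by omega
  have hside : 1 ≤ deg D z → ∀ A' : Finset {v : V // v ≠ z}, A'.card = 4 → BipSub (del D z) A' →
      (∃ A : Finset V, A.card = 4 ∧ BipSub D A) ∨
        (∑ v, deg D v * deg D v + 4 * (Fintype.card V - 5) + (2 * Fintype.card V - 14) ≤
          D.edgeFinset.card * Fintype.card V) ∨
        (T + (Fintype.card V - 6) ≤ deg D z * (Fintype.card V - 6) + 4) := by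
    intro hd1 A' hA'card hB
    have := four_four_sides_T D hk hm z hd1 (by omega) A' hA'card hB (by rw [hm'def]; omega) hcap6
    rw [hTdef] at this
    exact this
  have hd : deg D z = 0 ∨ deg D z = 1 ∨ deg D z = 2 ∨ deg D z = 3 := by omega
  rcases hd with hd0 | hd1 | hd2 | hd3
  · -- `d = 0`: the diagonal `(k − 1, 4, 0)`
    have hm'0 : m' = 4 * s + 28 := by omega
    rcases diag_second_order_gen (del D z) hK' 4 (le_refl 4) (by omega) (by rw [hm'def, hcardW', hm'0]; omega)
      with ⟨A', hA'card, hB⟩ | hgap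
    · obtain ⟨B, hBcard, hBsub⟩ := bipSub_lift D z A' hB (fun a ha => by
        have : a ∈ Nz := (hmemNz a).mpr ha
        rw [hd0, card_eq_zero] at hNz
        rw [hNz] at this
        exact absurd this (notMem_empty a))
      exact Or.inl ⟨B, by rw [hBcard, hA'card], hBsub⟩
    · right
      rw [hS'def, hm'def, hcardW'] at hgap
      rw [hd0, hs] at hT
      rw [hsq, ← hedges', hs, hd0]
      exact four_four_T_del_zero s m' S' T hm'0 hgap hT
  · -- `d = 1`: the cell `(k − 1, 4, 1)`
    have hm'1 : m' = 4 * s + 27 := by omega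
    rcases one_below_second_order_gen (del D z) hK' 4 (le_refl 4) (by omega)
      (by rw [hm'def, hcardW', hm'1]; omega) with ⟨A', hA'card, hB⟩ | hgap
    · rcases hside (by omega) A' hA'card hB with h | h | hT'
      · exact Or.inl h
      · exact Or.inr h
      · right
        have hS := sum_deg_sq_le_of_bipSub (del D z) A' hB 4 1 hA'card (by rw [hm'def, hcardW', hm'1]; omega)
          (by omega)
        rw [hS'def, hm'def, hcardW'] at hS
        rw [hs, hd1] at hT'
        rw [hsq, ← hedges', hs, hd1]
        exact four_four_T_del_one_mixed s m' S' T hm'1 hS hT'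
    · right
      rw [hS'def, hm'def, hcardW'] at hgap
      rw [hd1, hs] at hT
      rw [hsq, ← hedges', hs, hd1]
      exact four_four_T_del_one_gap s m' S' T hm'1 hgap hT
  · -- `d = 2`: the cell `(k − 1, 4, 2)`
    have hm'2 : m' = 4 * s + 26 := by omega
    rcases four_two_second_order (del D z) hK' (by omega) (by rw [hm'def, hcardW', hm'2]; omega)
      with ⟨A', hA'card, hB⟩ | hgap
    · rcases hside (by omega) A' hA'card hB with h | h | hT'
      · exact Or.inl h
      · exact Or.inr h
      · right
        have hS := sum_deg_sq_le_of_bipSub (del D z) A' hB 4 2 hA'card (by rw [hm'def, hcardW', hm'2]; omega)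
          (by omega)
        rw [hS'def, hm'def, hcardW'] at hS
        rw [hs, hd2] at hT'
        rw [hsq, ← hedges', hs, hd2]
        exact four_four_T_del_two_mixed s m' S' T hm'2 hS hT'
    · right
      rw [hS'def, hm'def, hcardW'] at hgap
      rw [hd2, hs] at hT
      rw [hsq, ← hedges', hs, hd2]
      exact four_four_T_del_two_gap s m' S' T hm'2 hgap hT
  · -- `d = 3`: the cell `(k − 1, 4, 3)`
    have hm'3 : m' = 4 * s + 25 := by omega
    rcases four_three_second_order (del D z) hK' (by omega) (by rw [hm'def, hcardW', hm'3]; omega)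
      with ⟨A', hA'card, hB⟩ | hgap
    · rcases hside (by omega) A' hA'card hB with h | h | hT'
      · exact Or.inl h
      · exact Or.inr h
      · right
        have hS := sum_deg_sq_le_of_bipSub (del D z) A' hB 4 3 hA'card (by rw [hm'def, hcardW', hm'3]; omega)
          (by omega)
        rw [hS'def, hm'def, hcardW'] at hS
        rw [hs, hd3] at hT'
        rw [hsq, ← hedges', hs, hd3]
        exact four_four_T_del_three_mixed s m' S' T hm'3 hS hT'
    · right
      rw [hS'def, hm'def, hcardW'] at hgap
      rw [hd3, hs] at hT
      rw [hsq, ← hedges', hs, hd3]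
      exact four_four_T_del_three_gap s m' S' T hm'3 hgap hT

/-- **THE NON-BIPARTITE SECOND-BEST VALUE ON `(k, 4, 4)`, `k ≥ 12`:** every non-`4`-bipartite `K₄⁻`-free graph on
`Fin k` with `4 (k − 4) − 4` edges has `Σ_v d(v)² + 4 (k − 5) + (2k − 14) ≤ m k`, and the value is attained by the
one-triangle family `tFamilyGen (k − 1) 4 2`, bipartite for no `A`. -/
theorem four_four_nonbip_second_best (k : ℕ) (hk : 12 ≤ k) :
    (∀ (D : SimpleGraph (Fin k)) [DecidableRel D.Adj], K4mFree D → D.edgeFinset.card + 4 = 4 * (k - 4) →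
        (¬ ∃ A : Finset (Fin k), A.card = 4 ∧ BipSub D A) →
        ∑ v, deg D v * deg D v + 4 * (k - 5) + (2 * k - 14) ≤ D.edgeFinset.card * k) ∧
      ∃ (D : SimpleGraph (Fin k)) (_ : DecidableRel D.Adj), K4mFree D ∧ D.edgeFinset.card + 4 = 4 * (k - 4) ∧
        (∀ A : Finset (Fin k), ¬ BipSub D A) ∧
        ∑ v, deg D v * deg D v + 4 * (k - 5) + (2 * k - 14) = D.edgeFinset.card * k := by
  have hcard : Fintype.card (Fin k) = k := Fintype.card_fin k
  refine ⟨?_, ?_⟩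
  · intro D _ hK hm hnb
    rcases four_four_second_order_T D hK (by omega) (by rw [hcard]; exact hm) with h | h
    · exact absurd h hnb
    · rw [hcard] at h
      exact h
  · obtain ⟨n, rfl⟩ : ∃ n, k = n + 1 := ⟨k - 1, by omega⟩
    obtain ⟨hK, hE, hS, hnb⟩ := tFamilyGen_value n 4 2 (by norm_num) (by omega) (by omega)
    refine ⟨tFamilyGen n 4 2 (by omega), inferInstance, hK, ?_, hnb, ?_⟩
    · have e : 2 + 4 - 2 = 4 := by norm_num
      rw [e] at hE
      have e2 : n + 1 - 4 = n - 3 := by omega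
      rw [e2]
      have e3 : n - 3 = n + 1 - 4 := by omega
      rw [e3]
      exact hE
    · have e : 2 + 4 - 2 = 4 := by norm_num
      rw [e] at hS
      have e1 : n + 1 - 1 - 4 = n + 1 - 5 := by omega
      rw [e1] at hS
      omega

end C047

end TriangleCap

end PercRepro
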